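import Literature.Geometry.Manifold.DeRhamLocalToSubset
import HarnessLib

/-!
# Pull-back of the de Rham complexes of open sets along maps of pairs

For a `C^∞` map `f : M → N` of manifolds and open sets `W₁ ⊆ M`, `W ⊆ N` with `f(W₁) ⊆ W`, the
pull-back of forms followed by restriction to `W₁`,
`localDeRhamComplex.pullbackPair I hf hW₁ hW hfW : Ω•(W) ⟶ Ω•(W₁)` (`η ↦ (f^* η)|_{W₁}`),
is a morphism of cochain complexes (Warner (1983), 2.22–2.23), and the de Rham comparison
`localDeRhamToSubset` (Bredon (1993), Thm. V.9.5) is natural for it: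
`H(pullbackPair) ≫ localDeRhamToSubset_{W₁} = localDeRhamToSubset_W ≫ f^*`
(`localDeRhamToSubset_pullbackPair`), the map `f^*` being the pull-back
`subsetCochains.pullH f hfW` of the cohomology of chains in subsets.  This is the "maps of pairs"
form of the tree's `localDeRhamComplex.pullbackInto` (the case `W₁ = univ`) and of
`localDeRhamComplex.res` (the case `f = id`).

Everything is proved; no named facts.

## References

* [Bredon1993] G. E. Bredon, *Topology and Geometry*, GTM 139 (1993), §V.9, Thm. V.9.5.
* [WarnerGTM94] F. W. Warner, *Foundations of Differentiable Manifolds and Lie Groups* (1983), 2.22–2.23.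
* [LeeSmoothManifolds2013] J. M. Lee, *Introduction to Smooth Manifolds*, 2nd ed., Prop. 18.9, Thm. 18.14.
-/

noncomputable section

-- see "Implementation notes" in `…SingularHomology.SingularChainsConcrete`
set_option backward.isDefEq.respectTransparency false

open scoped Manifold ContDiff Topology
open CategoryTheory Limits Set Literature.AlgebraicTopology.SingularHomology Literature.Geometry.Kaehler

universe u

namespace Literature.Geometry.Manifold

variable {E : Type u} [NormedAddCommGroup E] [NormedSpace ℝ E] {H : Type u} [TopologicalSpace H]
  {I : ModelWithCorners ℝ E H} {M : Type u} [TopologicalSpace M] [ChartedSpace H M] [IsManifold I ∞ M]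
  {E' : Type u} [NormedAddCommGroup E'] [NormedSpace ℝ E'] {H' : Type u} [TopologicalSpace H']
  {I' : ModelWithCorners ℝ E' H'} {N : Type u} [TopologicalSpace N] [ChartedSpace H' N] [IsManifold I' ∞ N]
  {f : M → N} (hf : ContMDiff I I' ∞ f) {W₁ : Set M} (hW₁ : IsOpen W₁) {W : Set N} (hW : IsOpen W)
  (hfW : MapsTo f W₁ W)

/-! ### Pull-back of forms along a map of pairs -/

include hf hW₁ hfW in
/-- The restriction to `W₁` of the pull-back along `f` of a form on `W` is a form on `W₁`
(`f(W₁) ⊆ W`; Warner (1983), 2.22, pointwise). [cite: WarnerGTM94, 2.22] -/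
theorem restr_pullback_mem_smoothFormsOn {k : ℕ} {η : MForm I' N ℝ k} (hη : η ∈ smoothFormsOn I' ℝ W k) :
    (η.pullback I f).restr W₁ ∈ smoothFormsOn I ℝ W₁ k :=
  ⟨fun _ hx ↦ (MForm.smoothAt_restr_iff hW₁ _ hx).2
      (MForm.SmoothAt.pullback (Filter.Eventually.of_forall fun _ ↦ hf.contMDiffAt) (hη.1 _ (hfW hx))),
    fun _ hx ↦ MForm.restr_apply_of_notMem _ hx⟩

include hf hW₁ hfW in
/-- `d_{W₁} ((f^* η)|_{W₁}) = (f^* (d_W η))|_{W₁}`. [cite: WarnerGTM94, Prop. 2.23] -/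
theorem restr_mextDeriv_restr_pullback {k : ℕ} {η : MForm I' N ℝ k} (hη : η ∈ smoothFormsOn I' ℝ W k) :
    (mextDeriv ((η.pullback I f).restr W₁)).restr W₁ = (((mextDeriv η).restr W).pullback I f).restr W₁ := by
  funext x
  by_cases hx : x ∈ W₁
  · rw [MForm.restr_apply_of_mem _ hx, MForm.restr_apply_of_mem _ hx, mextDeriv_restr_apply hW₁ _ hx,
      mextDeriv_pullback_apply (Filter.Eventually.of_forall fun _ ↦ hf.contMDiffAt) (hη.1 _ (hfW hx))]
    ext v
    rw [MForm.pullback_apply, MForm.pullback_apply, MForm.restr_apply_of_mem _ (hfW hx)]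
  · rw [MForm.restr_apply_of_notMem _ hx, MForm.restr_apply_of_notMem _ hx]

variable (I) in
/-- **Pull-back of de Rham complexes of open sets along a map of pairs** `f : (M, W₁) → (N, W)`:
`η ↦ (f^* η)|_{W₁}`, a morphism of cochain complexes `Ω•(W) ⟶ Ω•(W₁)` (Warner (1983), 2.22–2.23).
[cite: WarnerGTM94, Prop. 2.23] -/
def localDeRhamComplex.pullbackPair : localDeRhamComplex I' ℝ hW ⟶ localDeRhamComplex I ℝ hW₁ where
  f k := ModuleCat.ofHom
    { toFun := fun η ↦ ⟨((η.1 : MForm I' N ℝ k).pullback I f).restr W₁, restr_pullback_mem_smoothFormsOn hf hW₁ hfW η.2⟩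
      map_add' := fun η η' ↦ Subtype.ext (by
        change (((η.1 : MForm I' N ℝ k) + η'.1).pullback I f).restr W₁ = _
        rw [MForm.pullback_add, MForm.restr_add]
        rfl)
      map_smul' := fun c η ↦ Subtype.ext (by
        change ((c • (η.1 : MForm I' N ℝ k)).pullback I f).restr W₁ = _
        rw [MForm.pullback_smul, MForm.restr_smul]
        rfl) }
  comm' i j hij := by
    change i + 1 = j at hij
    subst hij
    rw [localDeRhamComplex_d, localDeRhamComplex_d]
    refine ModuleCat.hom_ext (LinearMap.ext fun η ↦ Subtype.ext ?_)
    exact restr_mextDeriv_restr_pullback hf hW₁ hfW η.2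

/-- The pull-back morphism on an element. [folklore] -/
@[simp]
theorem localDeRhamComplex.pullbackPair_f_apply_coe (k : ℕ) (η : (localDeRhamComplex I' ℝ hW).X k) :
    ((localDeRhamComplex.pullbackPair I hf hW₁ hW hfW).f k η).1 = ((η.1 : MForm I' N ℝ k).pullback I f).restr W₁ :=
  rfl

/-- **Push-forward of smooth chains in `W₁` to smooth chains in `W`** along `f`. [cite: LeeSmoothManifolds2013, Ch. 18 p. 474] -/
abbrev smoothPushPair : (smoothChainsInSub I ℝ ℝ M W₁).toComplex ⟶ (smoothChainsInSub I' ℝ ℝ N W).toComplex :=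
  Subcomplex.subMap (csingularChainComplex.map ℝ ℝ ⟨f, hf.continuous⟩) _ _ (smoothChainsInSub_le_comap_map hf hfW)

/-- **Naturality of the de Rham homomorphism for maps of pairs**: `pullbackPair ≫ Ψ_{W₁} = Ψ_W ≫ (f♯)^*`,
i.e. `∫_c (f^*η)|_{W₁} = ∫_{f♯ c} η` for smooth chains `c` in `W₁` (Lee (2013), Prop. 18.9 (c)).
[cite: LeeSmoothManifolds2013, Thm. 18.14] -/
theorem pullbackPair_comp_deRhamMap :
    localDeRhamComplex.pullbackPair I hf hW₁ hW hfW ≫ deRhamMap I hW₁ =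
      deRhamMap I' hW ≫ dualMap ℝ realCoeff (smoothPushPair hf hfW) := by
  ext k η
  change (deRhamMap I _).f k ((localDeRhamComplex.pullbackPair I hf hW₁ hW hfW).f k η) =
    (dualMap ℝ realCoeff (smoothPushPair hf hfW)).f k ((deRhamMap I' _).f k η)
  rw [dualMap_f_apply]
  refine ModuleCat.hom_ext (LinearMap.ext fun c ↦ ULift.ext _ _ ?_)
  change integrationFunctional (((η.1 : MForm I' N ℝ k).pullback I f).restr W₁) c.1 =
    integrationFunctional (η.1 : MForm I' N ℝ k) ((smoothPushPair hf hfW).f k c).1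
  rw [integrationFunctional_restr _ c.2.2, Subcomplex.subMap_f_apply_val, csingularChainComplex.map_f_apply,
    integrationFunctional_mapDomain hf _ c.2.1]

omit [IsManifold I ∞ M] [IsManifold I' ∞ N] in
/-- **Naturality of restriction to smooth chains for maps of pairs**:
`toSmooth_W ≫ (f♯^{sm})^* = (f♯)^* ≫ toSmooth_{W₁}`. [folklore] -/
theorem toSmooth_comp_dualMap_smoothPushPair [IsManifold I ∞ M] [IsManifold I' ∞ N] :
    smoothSubsetCochains.toSmooth I' ℝ realCoeff.{u} W ≫ dualMap ℝ realCoeff (smoothPushPair hf hfW) =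
      subsetCochains.pull ℝ realCoeff.{u} ⟨f, hf.continuous⟩ hfW ≫
        smoothSubsetCochains.toSmooth I ℝ realCoeff.{u} W₁ := by
  rw [smoothSubsetCochains.toSmooth, smoothSubsetCochains.toSmooth, subsetCochains.pull, ← dualMap_comp,
    ← dualMap_comp]
  congr 1

variable [I.Boundaryless] [FiniteDimensional ℝ E] [T2Space M] [SecondCountableTopology M] [LocallyCompactSpace M]
  [I'.Boundaryless] [FiniteDimensional ℝ E'] [T2Space N] [SecondCountableTopology N] [LocallyCompactSpace N]

/-- **`localDeRhamToSubset` is natural for maps of pairs**: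
`H(pullbackPair) ≫ localDeRhamToSubset_{W₁} = localDeRhamToSubset_W ≫ f^*`. [cite: Bredon1993, Thm. V.9.5] -/
@[reassoc]
theorem localDeRhamToSubset_pullbackPair (k : ℕ) :
    HomologicalComplex.homologyMap (localDeRhamComplex.pullbackPair I hf hW₁ hW hfW) k ≫ localDeRhamToSubset I hW₁ k =
      localDeRhamToSubset I' hW k ≫ subsetCochains.pullH (N := realCoeff.{u}) ⟨f, hf.continuous⟩ hfW k := by
  haveI : Fact (IsOpen W₁) := ⟨hW₁⟩
  apply (cancel_mono (HomologicalComplex.homologyMap (smoothSubsetCochains.toSmooth I ℝ realCoeff.{u} W₁) k)).1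
  simp only [Category.assoc, localDeRhamToSubset_comp_toSmooth]
  rw [← HomologicalComplex.homologyMap_comp, pullbackPair_comp_deRhamMap hf hW₁ hW hfW]
  change _ = _ ≫ HomologicalComplex.homologyMap (subsetCochains.pull ℝ realCoeff.{u} ⟨f, hf.continuous⟩ hfW) k ≫ _
  conv_rhs => rw [← HomologicalComplex.homologyMap_comp, ← toSmooth_comp_dualMap_smoothPushPair hf hfW,
    HomologicalComplex.homologyMap_comp, localDeRhamToSubset_comp_toSmooth_assoc]
  rw [HomologicalComplex.homologyMap_comp]

/-- The same, applied to a class. [cite: Bredon1993, Thm. V.9.5] -/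
theorem localDeRhamToSubset_pullbackPair_apply (k : ℕ) (y : (localDeRhamComplex I' ℝ hW).homology k) :
    localDeRhamToSubset I hW₁ k (HomologicalComplex.homologyMap (localDeRhamComplex.pullbackPair I hf hW₁ hW hfW) k y) =
      subsetCochains.pullH (N := realCoeff.{u}) ⟨f, hf.continuous⟩ hfW k (localDeRhamToSubset I' hW k y) := by
  rw [← ModuleCat.comp_apply, localDeRhamToSubset_pullbackPair, ModuleCat.comp_apply]

end Literature.Geometry.Manifold
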